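/-
Copyright (c) 2026 the pub-hodgecm-mathlib formalisation cell (harness21).  Prover seat hodgecm-mathlib-K2E3-p26 (g2), Track B «K2-LIT» (valve hand → L1),
#184♮ = hLiu418 = `stmt-HodgeConjecture-24832`; socket #41, KIND 1, organ (K1b-W) (line lead ∕ desk K2Liu-p14 (g4)), brick (KW1-c), piece (c5): THE `hUK` BINDER OF ★ (c4) ED. 2
PAID DEF-FREE on `H(F_v) = localPi` from the local height of the adelic translate (K2 bus 2026-09-04T23:31:54Z).
THEOREMS ONLY (no `def`, no `instance`, no notation, no named-fact hypothesis, no `sorry`); lane `--supports stmt-HodgeConjecture-24832` (count-neutral helper; closes no socket by itself).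
-/
import Summits.HodgeConjecture.HodgeConjecture.Theorems.K2LiuLocalHeightConjugatePlace   -- ★ (R-a) p863068 (this seat): `localHeight_smul_le_of_mem_unitaryGroupOfForm`; brings ★ (c1) `K2LiuLocalHeightLevelConjugation` (`conj_mem_congruenceGL_of_nnnorm_le`, `nnnorm_apply_le_localHeight`, `exists_localHeight_eq_pow`)
import Literature.NumberTheory.Automorphic.UnitaryGroupAdelicProduct                  -- ★ `finPart : U(J)(𝔸_F) →* U(J)(𝔸_{F,f})`; brings ★ `UnitaryGroupRestrictedProduct` (`evalPlace`, `coe_evalPlace_apply`), ★ `localPi`, ★ `GaloisActionPlaces` (`absNorm_algEquiv_smul`)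
import HarnessLib

/-!
# Crux `HLiu418`, socket #41, (K1b-W) brick (KW1-c), piece (c5) — `K2LiuKindOneLineLevelConjugation`: THE `hUK` LETTER OF ★ (c4) ED. 2 ON `H(F_v)`, DEF-FREE — A LOCAL POINT WHOSE
# `w`-COMPONENTS HAVE ENTRIES `≤ q_w^{a_w}` CONJUGATES THE LEVEL `⨅_w K_w(ϖ_w^{m_w + 2a_w})` INTO `⨅_w K_w(ϖ_w^{m_w})`; FOR THE `v`-COMPONENT OF AN ADELIC POINT, `q_w^{a_w} = H_w(g)`

Cell `hodgecm-mathlib`, crux item hLiu418 = `stmt-HodgeConjecture-24832` (helper lane `--supports … --as helper`, count-neutral), route of record `HCCMUnconditional`;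
squad K2 ∕ K2Liu (L1, LEAD F0P6-plan (g14)), road `K2_Liu`, socket #41, KIND 1, organ (K1b-W) (line lead ∕ (K1b-W) desk K2Liu-p14 (g4), BATCH #139), brick (KW1-c) of K2E3-p26 (g2):
(c1) ★ p862721 · (c2) ★ p862738 · HEAD ★ p862891 · (c4) ★ p862912 ∕ p862950 ∕ p863010 · (R-a) ★ p863068 · THIS FILE = (c5).  ★ (c4) ed. 2 `v_le_exp_of_integral_mul_translate_ne_zero`
takes BY VALUE `hUK : ∀ u ∈ U, g⁻¹·u·g ∈ K` for subgroups `U, K ≤ H(F_v) = UnitaryGroup.localPi E c N J v` and the local translate `g ∈ H(F_v)`.  Here it is PAID with the DEF-FREE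
levels of ★ `UnitaryGroupIntegralPointsReductionInert` §4, intersected over the places `w ∣ v` (so split and non-split `v` are ONE statement):
`K_v(m) := ⨅_{w ∣ v} (congruenceGL N (valuation ϖ_w ^ m_w)).comap (w-component ∘ subtype)`, `U := K_v(m + 2a)`, `K := K_v(m)`, for any `g ∈ H(F_v)` whose `w`-components
`g_w, g_w⁻¹` have entries of norm `≤ q_w^{a_w}` (★ (c1) `conj_mem_congruenceGL_of_nnnorm_le`, place by place); and for the `v`-component `g_v = evalPlace v (finPart g)` of an ADELIC
point `g ∈ H(𝔸_F)` the entry bound is the local height `H_w(g)` of ★ `GLn.localHeight` (★ (c1) `nnnorm_apply_le_localHeight`; `(g_v)_w = GL_N(x ↦ x_w)(g)` definitionally), with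
`H_w(g) = q_w^{a_w}` exactly available (★ (c1) `exists_localHeight_eq_pow`) and, at the conjugate place `c·w` of a split `v`, `H_{c·w}(g) ≤ q_w^{j + a + j}` from `H_w(g) ≤ q_w^a`,
`H_w(J) ≤ q_w^j` (★ (R-a) `localHeight_smul_le_of_mem_unitaryGroupOfForm`, `N(c·w) = N(w)` ★ `absNorm_algEquiv_smul`).
* §1 `coe_conj_apply`, **`conj_apply_mem_congruenceGL`** (one place), **`conj_mem_iInf_comap_congruenceGL`** (= `hUK` for `U := K_v(m + 2a)`, `K := K_v(m)`).
* §2 `coe_evalPlace_finPart`, `nnnorm_evalPlace_finPart_apply_le`, **`evalPlace_finPart_conj_apply_mem_congruenceGL`**, **`evalPlace_finPart_conj_mem_iInf_comap_congruenceGL`**,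
  `exists_forall_localHeight_eq_pow` (the exponents `a_w` with `H_w(g) = q_w^{a_w}`, all `w ∣ v`).
* §3 `mem_unitaryGroupOfForm_of_coe_eq`, **`localHeight_smul_le_pow_of_le_pow`** (`H_{c·w}(g) ≤ q_{c·w}^{j+a+j}`) — the (R-a) dress for the second place over a split `v`.
[Casselman1980, §3]; [BorelJacquet1979, §1.2, §4.1]; [PlatonovRapinchuk1994, §5.1]; [HarishChandra1999, §17].

HONEST LABEL.  Count-neutral helper; it retires nothing by itself: `HC_CM` is proved only modulo the 7 printed citations (2 remaining named inputs:
hLiu418 = `stmt-HodgeConjecture-24832`, h413 = `stmt-HodgeConjecture-24833`) until rung 0 closes.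

## References
* [Casselman1980] W. Casselman, *The unramified principal series of p-adic groups I*, Compositio Math. 40 (1980), §3.
* [BorelJacquet1979] A. Borel, H. Jacquet, *Automorphic forms and automorphic representations*, Proc. Sympos. Pure Math. 33.1 (1979), §1.2, §4.1.
* [PlatonovRapinchuk1994] V. Platonov, A. Rapinchuk, *Algebraic Groups and Number Theory* (1994), §5.1 (adelic points, congruence subgroups `G_{𝒪_v}(𝔭_v^m)`).
* [HarishChandra1999] Harish-Chandra (notes by DeBacker–Sally), *Admissible invariant distributions on reductive p-adic groups*, AMS ULS 16 (1999), §17 p. 80.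
-/

set_option autoImplicit false
-- the mandated namespace repeats the single-problem summit's segment (`HodgeConjecture.HodgeConjecture`)
set_option linter.dupNamespace false

noncomputable section

open scoped NNReal MatrixGroups
open NumberField IsDedekindDomain Matrix ValuativeRel
open Literature.NumberTheory.Automorphic Literature.NumberTheory.Automorphic.UnitaryGroup

namespace Summit.HodgeConjecture.HodgeConjecture.Cruxes.HLiu418.K2LiuKindOneLineLevelConjugation

open Summit.HodgeConjecture.HodgeConjecture.Cruxes.HLiu418.K2LiuLocalHeightLevelConjugation
  (conj_mem_congruenceGL_of_nnnorm_le nnnorm_apply_le_localHeight exists_localHeight_eq_pow)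
open Summit.HodgeConjecture.HodgeConjecture.Cruxes.HLiu418.K2LiuLocalHeightConjugatePlace (localHeight_smul_le_of_mem_unitaryGroupOfForm)

variable (F : Type) [Field F] [NumberField F] (E : Type) [Field E] [NumberField E] [Algebra F E] (c : E ≃ₐ[F] E) (N : ℕ) (J : Matrix (Fin N) (Fin N) E)
  (v : HeightOneSpectrum (𝓞 F))

/-! ## §1 Conjugating levels on `H(F_v) = localPi`, place by place over `v` -/

/-- components of a conjugate: `(g⁻¹·u·g)_w = g_w⁻¹·u_w·g_w` (definitional). [folklore] -/
theorem coe_conj_apply (g u : localPi E c N J v) (w : PlacesOver E v) :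
    ((g⁻¹ * u * g : localPi E c N J v) : LocalGLPi E N v) w = ((g : LocalGLPi E N v) w)⁻¹ * (u : LocalGLPi E N v) w * (g : LocalGLPi E N v) w := rfl

/-- **ONE PLACE**: if the `w`-components `g_w`, `g_w⁻¹` of `g ∈ H(F_v)` have entries of norm `≤ q_w^a` and `u_w ∈ K_w(ϖ_w^{m+2a})`, then `(g⁻¹·u·g)_w ∈ K_w(ϖ_w^m)` (★ (c1)
`conj_mem_congruenceGL_of_nnnorm_le` at `x := g_w`). [cite: HarishChandra1999, §17 p. 80] [cite: Casselman1980, §3] -/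
theorem conj_apply_mem_congruenceGL (g u : localPi E c N J v) (w : PlacesOver E v) (m a : ℕ)
    (hg : ∀ i j, ‖(((g : LocalGLPi E N v) w : GL (Fin N) (w.1.adicCompletion E)).val i j)‖₊ ≤ ((Ideal.absNorm w.1.asIdeal : ℕ) : ℝ≥0) ^ a)
    (hg' : ∀ i j, ‖((((g : LocalGLPi E N v) w)⁻¹ : GL (Fin N) (w.1.adicCompletion E)).val i j)‖₊ ≤ ((Ideal.absNorm w.1.asIdeal : ℕ) : ℝ≥0) ^ a)
    {ϖ : w.1.adicCompletion E} (hϖ : Valued.v ϖ = WithZero.exp (-1 : ℤ))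
    (hu : (u : LocalGLPi E N v) w ∈ congruenceGL N (valuation (w.1.adicCompletion E) ϖ ^ (m + 2 * a))) :
    ((g⁻¹ * u * g : localPi E c N J v) : LocalGLPi E N v) w ∈ congruenceGL N (valuation (w.1.adicCompletion E) ϖ ^ m) :=
  (conj_mem_congruenceGL_of_nnnorm_le E w.1 ((g : LocalGLPi E N v) w) m a hg hg' hϖ hu).2

/-- **THE `hUK` LETTER, DEF-FREE** (`U := K_v(m + 2a)`, `K := K_v(m)`, levels intersected over `w ∣ v`): if every `w`-component of `g ∈ H(F_v)` and of `g⁻¹` has entries of norm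
`≤ q_w^{a_w}`, then `u ∈ ⨅_w K_w(ϖ_w^{m_w + 2a_w}) ⟹ g⁻¹·u·g ∈ ⨅_w K_w(ϖ_w^{m_w})`. [cite: HarishChandra1999, §17 p. 80] [cite: PlatonovRapinchuk1994, §5.1] -/
theorem conj_mem_iInf_comap_congruenceGL (g : localPi E c N J v) (m a : PlacesOver E v → ℕ) (ϖ : (w : PlacesOver E v) → w.1.adicCompletion E)
    (hϖ : ∀ w, Valued.v (ϖ w) = WithZero.exp (-1 : ℤ))
    (hg : ∀ (w : PlacesOver E v) (i j : Fin N), ‖(((g : LocalGLPi E N v) w : GL (Fin N) (w.1.adicCompletion E)).val i j)‖₊ ≤ ((Ideal.absNorm w.1.asIdeal : ℕ) : ℝ≥0) ^ a w)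
    (hg' : ∀ (w : PlacesOver E v) (i j : Fin N), ‖((((g : LocalGLPi E N v) w)⁻¹ : GL (Fin N) (w.1.adicCompletion E)).val i j)‖₊ ≤ ((Ideal.absNorm w.1.asIdeal : ℕ) : ℝ≥0) ^ a w)
    {u : localPi E c N J v}
    (hu : u ∈ ⨅ w : PlacesOver E v, (congruenceGL N (valuation (w.1.adicCompletion E) (ϖ w) ^ (m w + 2 * a w))).comap
      ((Pi.evalMonoidHom (fun w' : PlacesOver E v => GL (Fin N) (w'.1.adicCompletion E)) w).comp (localPi E c N J v).subtype)) :
    g⁻¹ * u * g ∈ ⨅ w : PlacesOver E v, (congruenceGL N (valuation (w.1.adicCompletion E) (ϖ w) ^ (m w))).comap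
      ((Pi.evalMonoidHom (fun w' : PlacesOver E v => GL (Fin N) (w'.1.adicCompletion E)) w).comp (localPi E c N J v).subtype) := by
  rw [Subgroup.mem_iInf] at hu ⊢
  exact fun w => conj_apply_mem_congruenceGL F E c N J v g u w (m w) (a w) (hg w) (hg' w) (hϖ w) (hu w)

/-! ## §2 The `v`-component of an adelic point: entry bounds = the local height -/

/-- `(g_v)_w = GL_N(x ↦ x_w)(g)` for `g_v = evalPlace v (finPart g)`, `g ∈ H(𝔸_F)` (definitional). [cite: BorelJacquet1979, §4.1] -/
theorem coe_evalPlace_finPart (g : (adelicGroupData F E c N J).Adelic) (w : PlacesOver E v) :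
    ((evalPlace F E c N J v (finPart F E c N J g) : localPi E c N J v) : LocalGLPi E N v) w =
      Matrix.GeneralLinearGroup.map (AdelicGroupData.adeleEval E w.1) (adelicVal F E c N J g) := rfl

/-- **Entries of `(g_v)_w` and `(g_v)_w⁻¹` are `≤ H_w(g)`** (★ (c1) `nnnorm_apply_le_localHeight`). [cite: BorelJacquet1979, §1.2] -/
theorem nnnorm_evalPlace_finPart_apply_le (g : (adelicGroupData F E c N J).Adelic) (w : PlacesOver E v) (i j : Fin N) :
    ‖((((evalPlace F E c N J v (finPart F E c N J g) : localPi E c N J v) : LocalGLPi E N v) w : GL (Fin N) (w.1.adicCompletion E)).val i j)‖₊ ≤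
        GLn.localHeight N E w.1 (adelicVal F E c N J g) ∧
      ‖(((((evalPlace F E c N J v (finPart F E c N J g) : localPi E c N J v) : LocalGLPi E N v) w)⁻¹ : GL (Fin N) (w.1.adicCompletion E)).val i j)‖₊ ≤
        GLn.localHeight N E w.1 (adelicVal F E c N J g) :=
  nnnorm_apply_le_localHeight E w.1 (adelicVal F E c N J g) i j

/-- **ONE PLACE, ADELIC**: `H_w(g) ≤ q_w^a`, `u_w ∈ K_w(ϖ_w^{m+2a})` ⟹ `(g_v⁻¹·u·g_v)_w ∈ K_w(ϖ_w^m)`. [cite: HarishChandra1999, §17 p. 80] [cite: BorelJacquet1979, §1.2, §4.1] -/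
theorem evalPlace_finPart_conj_apply_mem_congruenceGL (g : (adelicGroupData F E c N J).Adelic) (u : localPi E c N J v) (w : PlacesOver E v) (m a : ℕ)
    (hH : GLn.localHeight N E w.1 (adelicVal F E c N J g) ≤ ((Ideal.absNorm w.1.asIdeal : ℕ) : ℝ≥0) ^ a)
    {ϖ : w.1.adicCompletion E} (hϖ : Valued.v ϖ = WithZero.exp (-1 : ℤ))
    (hu : (u : LocalGLPi E N v) w ∈ congruenceGL N (valuation (w.1.adicCompletion E) ϖ ^ (m + 2 * a))) :
    (((evalPlace F E c N J v (finPart F E c N J g))⁻¹ * u * evalPlace F E c N J v (finPart F E c N J g) : localPi E c N J v) : LocalGLPi E N v) w ∈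
      congruenceGL N (valuation (w.1.adicCompletion E) ϖ ^ m) :=
  conj_apply_mem_congruenceGL F E c N J v _ u w m a (fun i j => (nnnorm_evalPlace_finPart_apply_le F E c N J v g w i j).1.trans hH)
    (fun i j => (nnnorm_evalPlace_finPart_apply_le F E c N J v g w i j).2.trans hH) hϖ hu

/-- **THE `hUK` LETTER FOR THE ADELIC TRANSLATE** (`g_v = evalPlace v (finPart g)`, `U := ⨅_w K_w(ϖ_w^{m_w + 2a_w})`, `K := ⨅_w K_w(ϖ_w^{m_w})`): `H_w(g) ≤ q_w^{a_w}` for all `w ∣ v`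
⟹ `∀ u ∈ U, g_v⁻¹·u·g_v ∈ K` — the binder of ★ (c4) ed. 2 `v_le_exp_of_integral_mul_translate_ne_zero`, paid from local heights alone. [cite: HarishChandra1999, §17 p. 80]
[cite: BorelJacquet1979, §1.2, §4.1] [cite: PlatonovRapinchuk1994, §5.1] -/
theorem evalPlace_finPart_conj_mem_iInf_comap_congruenceGL (g : (adelicGroupData F E c N J).Adelic) (m a : PlacesOver E v → ℕ)
    (ϖ : (w : PlacesOver E v) → w.1.adicCompletion E) (hϖ : ∀ w, Valued.v (ϖ w) = WithZero.exp (-1 : ℤ))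
    (hH : ∀ w : PlacesOver E v, GLn.localHeight N E w.1 (adelicVal F E c N J g) ≤ ((Ideal.absNorm w.1.asIdeal : ℕ) : ℝ≥0) ^ a w)
    (u : localPi E c N J v)
    (hu : u ∈ ⨅ w : PlacesOver E v, (congruenceGL N (valuation (w.1.adicCompletion E) (ϖ w) ^ (m w + 2 * a w))).comap
      ((Pi.evalMonoidHom (fun w' : PlacesOver E v => GL (Fin N) (w'.1.adicCompletion E)) w).comp (localPi E c N J v).subtype)) :
    (evalPlace F E c N J v (finPart F E c N J g))⁻¹ * u * evalPlace F E c N J v (finPart F E c N J g) ∈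
      ⨅ w : PlacesOver E v, (congruenceGL N (valuation (w.1.adicCompletion E) (ϖ w) ^ (m w))).comap
        ((Pi.evalMonoidHom (fun w' : PlacesOver E v => GL (Fin N) (w'.1.adicCompletion E)) w).comp (localPi E c N J v).subtype) :=
  conj_mem_iInf_comap_congruenceGL F E c N J v _ m a ϖ hϖ (fun w i j => (nnnorm_evalPlace_finPart_apply_le F E c N J v g w i j).1.trans (hH w))
    (fun w i j => (nnnorm_evalPlace_finPart_apply_le F E c N J v g w i j).2.trans (hH w)) hu

omit [NumberField F] in
/-- **The exponents**: `H_w(g) = q_w^{a_w}` for some `a : (w ∣ v) → ℕ` (★ (c1) `exists_localHeight_eq_pow` place by place). [cite: BorelJacquet1979, §1.2] -/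
theorem exists_forall_localHeight_eq_pow [NeZero N] (g : GL (Fin N) (AdeleRing (𝓞 E) E)) :
    ∃ a : PlacesOver E v → ℕ, ∀ w : PlacesOver E v, GLn.localHeight N E w.1 g = ((Ideal.absNorm w.1.asIdeal : ℕ) : ℝ≥0) ^ a w := by
  choose a ha using fun w : PlacesOver E v => exists_localHeight_eq_pow E w.1 g
  exact ⟨a, ha⟩

/-! ## §3 The second place over a split `v`: the (R-a) dress -/

/-- an adelic point of the datum lies in the unitary group of ANY invertible realisation `Jm` of the adelic form (`(Jm : Matrix) = adelicForm E N J`). [cite: PlatonovRapinchuk1994, §5.1] -/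
theorem mem_unitaryGroupOfForm_of_coe_eq (Jm : GL (Fin N) (AdeleRing (𝓞 E) E)) (hJm : (Jm : Matrix (Fin N) (Fin N) (AdeleRing (𝓞 E) E)) = adelicForm E N J)
    (g : (adelicGroupData F E c N J).Adelic) :
    (adelicVal F E c N J g) ∈ unitaryGroupOfForm (conjAdele F E c) (Jm : Matrix (Fin N) (Fin N) (AdeleRing (𝓞 E) E)) := by
  rw [hJm]
  exact g.2

/-- **`H_{c·w}(g) ≤ q_{c·w}^{j + a + j}`** from `H_w(g) ≤ q_w^a` and `H_w(J) ≤ q_w^j`, for `g ∈ H(𝔸_F)`, `c` an involution and `Jm` an invertible realisation of the adelic form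
(★ (R-a) `localHeight_smul_le_of_mem_unitaryGroupOfForm`, `N(c·w) = N(w)` ★ `absNorm_algEquiv_smul`): over a split `v = w·(c·w)` the level data at BOTH places is read from `H_w(g)`.
[cite: BorelJacquet1979, §1.2] [cite: PlatonovRapinchuk1994, §5.1] -/
theorem localHeight_smul_le_pow_of_le_pow (hcc : c * c = 1) (Jm : GL (Fin N) (AdeleRing (𝓞 E) E))
    (hJm : (Jm : Matrix (Fin N) (Fin N) (AdeleRing (𝓞 E) E)) = adelicForm E N J) (g : (adelicGroupData F E c N J).Adelic) (w : HeightOneSpectrum (𝓞 E)) {j a : ℕ}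
    (hJw : GLn.localHeight N E w Jm ≤ ((Ideal.absNorm w.asIdeal : ℕ) : ℝ≥0) ^ j)
    (hgw : GLn.localHeight N E w (adelicVal F E c N J g) ≤ ((Ideal.absNorm w.asIdeal : ℕ) : ℝ≥0) ^ a) :
    GLn.localHeight N E (c • w) (adelicVal F E c N J g) ≤ ((Ideal.absNorm (c • w).asIdeal : ℕ) : ℝ≥0) ^ (j + a + j) := by
  rw [HeightOneSpectrum.absNorm_algEquiv_smul F c w, pow_add, pow_add]
  exact (localHeight_smul_le_of_mem_unitaryGroupOfForm F E c hcc Jm (mem_unitaryGroupOfForm_of_coe_eq F E c N J Jm hJm g) w).trans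
    (mul_le_mul' (mul_le_mul' hJw hgw) hJw)

end Summit.HodgeConjecture.HodgeConjecture.Cruxes.HLiu418.K2LiuKindOneLineLevelConjugation

end
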